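import Summits.Langlands.Langlands.Theorems.IrreducibilityBySelfDualityHeckeEigenvalueFieldResConeAnalytic
import Literature.NumberTheory.Automorphic.AutomorphicLieDerivSkewAdjointArchGrowth
import Literature.NumberTheory.DiophantineGeometry.SchurWeylPlethysmPolynomialProofs
import HarnessLib

/-!
# Crux `HeckeEigenvalueField` (stmt-Langlands-13632), line `Sketch`, stub GROWTH-ω — part 1:
# polynomial growth of the coefficient representation `E_λ(ℂ) ⊗ ε_S`

Namespace `Summit.Langlands.Langlands.Theorems.HeckeEigenvalueField.Res`.  Theorems only; helper file
(part 1 of 5) for the registered stub `stub_coneForm_growth` (`…StubConeGrowth`): the cone form of a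
`(𝔤, K_∞)`-cochain has polynomial `C¹` growth on the positive cone.

1. Book-keeping of bounds `f ≤ C · sz^k` in an abstract size `sz ≥ 1` on any type (`cfg_add`,
   `cfg_mul`, `cfg_sum`, `cfg_prod`, `cfg_pow`, `cfg_mono`).
2. **The matrix coefficients of `E_λ(ℂ) ⊗ ε_S` grow polynomially**: for any size `sz(g) ≥ 1`
   dominating the entries of `g` and `g⁻¹` (`g ∈ G_∞ = GL_n(K_∞)`),
   `‖(E_λ ⊗ ε_S)(g) v‖ ≤ C sz(g)^k ‖v‖` (`cfg_archCoeffRepSign_growth`): a coefficient of the factor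
   `V_{λ_τ}(τ̃ g)` is `det(τ̃ g)^{λ_{τ,n}}` times a polynomial in the entries of `τ̃ g`
   (`isPolynomialRep_weylRep_holds`), `|τ̃ x| ≤ C ‖x‖`, `det(τ̃ g)⁻¹ = det(τ̃ g⁻¹)`, a pure tensor expands
   in the tensor basis, and `|ε_S| = 1`.

[cite: BorelWallach2000, VII §2.2] [cite: FultonHarrisGTM129, §15.5]
-/

set_option linter.dupNamespace false -- project-wide: `Summit.Langlands.Langlands` is the mandated namespace

noncomputable section

open scoped TensorProduct Classical Matrix ComplexConjugate
open Filter NumberField NumberField.mixedEmbedding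
open Literature.NumberTheory.Automorphic Literature.NumberTheory.Automorphic.RealMatrixGroup
  Literature.NumberTheory.Automorphic.ConeDictionary

namespace Summit.Langlands.Langlands.Theorems.HeckeEigenvalueField.Res

/-! ### 1. Book-keeping of polynomial bounds `f ≤ C · sz ^ k` in an abstract size `sz ≥ 1` -/

section Growth

variable {X : Type*} (sz : X → ℝ)

/-- Raising the exponent of a polynomial bound (`sz ≥ 1`). [folklore] -/
theorem cfg_exp_mono (hsz : ∀ x, 1 ≤ sz x) {f : X → ℝ} {C : ℝ} {k k' : ℕ} (hC : 0 ≤ C) (hk : k ≤ k')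
    (H : ∀ x, f x ≤ C * sz x ^ k) : ∀ x, f x ≤ C * sz x ^ k' := fun x =>
  (H x).trans (mul_le_mul_of_nonneg_left (pow_le_pow_right₀ (hsz x) hk) hC)

/-- Constants are polynomially bounded. [folklore] -/
theorem cfg_const (hsz : ∀ x, 1 ≤ sz x) (a : ℝ) :
    ∃ (C : ℝ) (k : ℕ), 0 ≤ C ∧ ∀ x, a ≤ C * sz x ^ k :=
  ⟨max a 0, 0, le_max_right _ _, fun x => by
    rw [pow_zero, mul_one]
    have := hsz x
    exact le_max_left _ _⟩

/-- Domination. [folklore] -/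
theorem cfg_mono {f g : X → ℝ} (hf : ∃ (C : ℝ) (k : ℕ), 0 ≤ C ∧ ∀ x, f x ≤ C * sz x ^ k)
    (hle : ∀ x, g x ≤ f x) : ∃ (C : ℝ) (k : ℕ), 0 ≤ C ∧ ∀ x, g x ≤ C * sz x ^ k := by
  obtain ⟨C, k, hC, H⟩ := hf
  exact ⟨C, k, hC, fun x => (hle x).trans (H x)⟩

/-- Sums. [folklore] -/
theorem cfg_add (hsz : ∀ x, 1 ≤ sz x) {f g : X → ℝ}
    (hf : ∃ (C : ℝ) (k : ℕ), 0 ≤ C ∧ ∀ x, f x ≤ C * sz x ^ k)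
    (hg : ∃ (C : ℝ) (k : ℕ), 0 ≤ C ∧ ∀ x, g x ≤ C * sz x ^ k) :
    ∃ (C : ℝ) (k : ℕ), 0 ≤ C ∧ ∀ x, f x + g x ≤ C * sz x ^ k := by
  obtain ⟨C₁, k₁, hC₁, H₁⟩ := hf
  obtain ⟨C₂, k₂, hC₂, H₂⟩ := hg
  refine ⟨C₁ + C₂, max k₁ k₂, add_nonneg hC₁ hC₂, fun x => ?_⟩
  rw [add_mul]
  exact add_le_add (cfg_exp_mono sz hsz hC₁ (le_max_left _ _) H₁ x)
    (cfg_exp_mono sz hsz hC₂ (le_max_right _ _) H₂ x)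

/-- Products of non-negative functions. [folklore] -/
theorem cfg_mul {f g : X → ℝ} (hf0 : ∀ x, 0 ≤ f x) (hg0 : ∀ x, 0 ≤ g x)
    (hf : ∃ (C : ℝ) (k : ℕ), 0 ≤ C ∧ ∀ x, f x ≤ C * sz x ^ k)
    (hg : ∃ (C : ℝ) (k : ℕ), 0 ≤ C ∧ ∀ x, g x ≤ C * sz x ^ k) :
    ∃ (C : ℝ) (k : ℕ), 0 ≤ C ∧ ∀ x, f x * g x ≤ C * sz x ^ k := by
  obtain ⟨C₁, k₁, hC₁, H₁⟩ := hf
  obtain ⟨C₂, k₂, hC₂, H₂⟩ := hg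
  refine ⟨C₁ * C₂, k₁ + k₂, mul_nonneg hC₁ hC₂, fun x => ?_⟩
  calc f x * g x ≤ (C₁ * sz x ^ k₁) * (C₂ * sz x ^ k₂) :=
        mul_le_mul (H₁ x) (H₂ x) (hg0 x) ((hf0 x).trans (H₁ x))
    _ = C₁ * C₂ * sz x ^ (k₁ + k₂) := by rw [pow_add]; ring

/-- Finite sums. [folklore] -/
theorem cfg_sum (hsz : ∀ x, 1 ≤ sz x) {ι : Type*} (s : Finset ι) {f : ι → X → ℝ}
    (H : ∀ i ∈ s, ∃ (C : ℝ) (k : ℕ), 0 ≤ C ∧ ∀ x, f i x ≤ C * sz x ^ k) :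
    ∃ (C : ℝ) (k : ℕ), 0 ≤ C ∧ ∀ x, ∑ i ∈ s, f i x ≤ C * sz x ^ k := by
  classical
  induction s using Finset.induction_on with
  | empty =>
    refine ⟨0, 0, le_rfl, fun x => ?_⟩
    rw [Finset.sum_empty, zero_mul]
  | insert a s ha ih =>
    obtain ⟨C, k, hC, hCk⟩ := cfg_add sz hsz (H a (Finset.mem_insert_self a s))
      (ih fun i hi => H i (Finset.mem_insert_of_mem hi))
    exact ⟨C, k, hC, fun x => by rw [Finset.sum_insert ha]; exact hCk x⟩

/-- Finite products of non-negative functions. [folklore] -/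
theorem cfg_prod (hsz : ∀ x, 1 ≤ sz x) {ι : Type*} (s : Finset ι) {f : ι → X → ℝ}
    (h0 : ∀ i ∈ s, ∀ x, 0 ≤ f i x)
    (H : ∀ i ∈ s, ∃ (C : ℝ) (k : ℕ), 0 ≤ C ∧ ∀ x, f i x ≤ C * sz x ^ k) :
    ∃ (C : ℝ) (k : ℕ), 0 ≤ C ∧ ∀ x, ∏ i ∈ s, f i x ≤ C * sz x ^ k := by
  classical
  induction s using Finset.induction_on with
  | empty =>
    refine ⟨1, 0, zero_le_one, fun x => ?_⟩
    rw [Finset.prod_empty, pow_zero, mul_one]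
  | insert a s ha ih =>
    have h0' : ∀ i ∈ s, ∀ x, 0 ≤ f i x := fun i hi => h0 i (Finset.mem_insert_of_mem hi)
    obtain ⟨C, k, hC, hCk⟩ := cfg_mul sz (h0 a (Finset.mem_insert_self a s))
      (fun x => Finset.prod_nonneg fun i hi => h0' i hi x)
      (H a (Finset.mem_insert_self a s)) (ih h0' fun i hi => H i (Finset.mem_insert_of_mem hi))
    have := hsz
    exact ⟨C, k, hC, fun x => by rw [Finset.prod_insert ha]; exact hCk x⟩

/-- Powers of a non-negative function. [folklore] -/
theorem cfg_pow (hsz : ∀ x, 1 ≤ sz x) {f : X → ℝ} (h0 : ∀ x, 0 ≤ f x)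
    (hf : ∃ (C : ℝ) (k : ℕ), 0 ≤ C ∧ ∀ x, f x ≤ C * sz x ^ k) (m : ℕ) :
    ∃ (C : ℝ) (k : ℕ), 0 ≤ C ∧ ∀ x, f x ^ m ≤ C * sz x ^ k := by
  have h := cfg_prod sz hsz (Finset.range m) (f := fun _ => f) (fun _ _ => h0) (fun _ _ => hf)
  simpa only [Finset.prod_const, Finset.card_range] using h

end Growth

/-! ### 3. Polynomial growth of the coefficient representation `E_λ(ℂ) ⊗ ε_S` -/

section CoeffGrowth

variable {n : ℕ} {K : Type} [Field K] [NumberField K]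
  (sz : (archGroupGL n K).carrier → ℝ)

/-- `|τ̃ x| ≤ C ‖x‖` uniformly in the complex embedding `τ` (the finitely many `τ̃` are `ℝ`-linear on
the finite-dimensional `K_∞`). [folklore] -/
theorem cfg_exists_norm_embeddingExt_le :
    ∃ C : ℝ, 0 ≤ C ∧ ∀ (τ : K →+* ℂ) (x : mixedSpace K), ‖embeddingExt τ x‖ ≤ C * ‖x‖ := by
  have h : ∀ τ : K →+* ℂ, ∃ C : ℝ, 0 ≤ C ∧ ∀ x : mixedSpace K, ‖embeddingExt τ x‖ ≤ C * ‖x‖ := fun τ =>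
    ⟨‖LinearMap.toContinuousLinearMap (embeddingExt τ).toLinearMap‖, norm_nonneg _, fun x =>
      (LinearMap.toContinuousLinearMap (embeddingExt τ).toLinearMap).le_opNorm x⟩
  choose C hC0 hC using h
  refine ⟨∑ τ, C τ, Finset.sum_nonneg fun τ _ => hC0 τ, fun τ x => (hC τ x).trans ?_⟩
  exact mul_le_mul_of_nonneg_right (Finset.single_le_sum (fun τ _ => hC0 τ) (Finset.mem_univ τ)) (norm_nonneg _)

/-- A polynomial in polynomially bounded complex quantities is polynomially bounded. [folklore] -/
theorem cfg_eval_growth (hsz : ∀ g, 1 ≤ sz g) {ι : Type*} {e : (archGroupGL n K).carrier → ι → ℂ}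
    (he : ∀ i, ∃ (C : ℝ) (k : ℕ), 0 ≤ C ∧ ∀ g, ‖e g i‖ ≤ C * sz g ^ k) (P : MvPolynomial ι ℂ) :
    ∃ (C : ℝ) (k : ℕ), 0 ≤ C ∧ ∀ g, ‖MvPolynomial.eval (e g) P‖ ≤ C * sz g ^ k := by
  induction P using MvPolynomial.induction_on with
  | C a =>
    obtain ⟨C, k, hC, h⟩ := cfg_const sz hsz ‖a‖
    exact ⟨C, k, hC, fun g => by rw [MvPolynomial.eval_C]; exact h g⟩
  | add p q hp hq =>
    exact cfg_mono sz (cfg_add sz hsz hp hq) fun g => by rw [map_add]; exact norm_add_le _ _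
  | mul_X p i hp =>
    exact cfg_mono sz (cfg_mul sz (fun _ => norm_nonneg _) (fun _ => norm_nonneg _) hp (he i)) fun g => by
      rw [map_mul, MvPolynomial.eval_X]; exact norm_mul_le _ _

/-- The determinant of a complex matrix with polynomially bounded entries is polynomially bounded.
[folklore] -/
theorem cfg_det_growth (hsz : ∀ g, 1 ≤ sz g) {m : (archGroupGL n K).carrier → Matrix (Fin n) (Fin n) ℂ}
    (hm : ∀ i j, ∃ (C : ℝ) (k : ℕ), 0 ≤ C ∧ ∀ g, ‖m g i j‖ ≤ C * sz g ^ k) :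
    ∃ (C : ℝ) (k : ℕ), 0 ≤ C ∧ ∀ g, ‖(m g).det‖ ≤ C * sz g ^ k := by
  have h : ∃ (C : ℝ) (k : ℕ), 0 ≤ C ∧ ∀ g,
      ∑ σ : Equiv.Perm (Fin n), ∏ i, ‖m g (σ i) i‖ ≤ C * sz g ^ k :=
    cfg_sum sz hsz _ fun σ _ => cfg_prod sz hsz _ (fun _ _ _ => norm_nonneg _) fun i _ => hm (σ i) i
  refine cfg_mono sz h fun g => ?_
  rw [Matrix.det_apply']
  refine (norm_sum_le _ _).trans (Finset.sum_le_sum fun σ _ => ?_)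
  have hε : ‖(((Equiv.Perm.sign σ : ℤˣ) : ℤ) : ℂ)‖ ≤ 1 := by
    rcases Int.units_eq_one_or (Equiv.Perm.sign σ) with h | h <;> simp [h]
  calc ‖(((Equiv.Perm.sign σ : ℤˣ) : ℤ) : ℂ) * ∏ i, m g (σ i) i‖
      ≤ ‖(((Equiv.Perm.sign σ : ℤˣ) : ℤ) : ℂ)‖ * ‖∏ i, m g (σ i) i‖ := norm_mul_le _ _
    _ ≤ 1 * ∏ i, ‖m g (σ i) i‖ := mul_le_mul hε (Finset.norm_prod_le _ _) (norm_nonneg _) zero_le_one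
    _ = ∏ i, ‖m g (σ i) i‖ := one_mul _

/-- **Matrix coefficients of the factors `V_{λ_τ}(τ̃ g)` are polynomially bounded** in the entries of
`g`, `g⁻¹`: such a coefficient is `det(τ̃ g)^{λ_{τ,n}}` times a polynomial in the entries of `τ̃ g`
(`isPolynomialRep_weylRep_holds`), and `det(τ̃ g)⁻¹ = det(τ̃ g⁻¹)`.
[cite: FultonHarrisGTM129, §15.5] -/
theorem cfg_factorRep_dual_growth (hsz : ∀ g, 1 ≤ sz g)
    (hE : ∀ (g : (archGroupGL n K).carrier) i j,
      ‖((g : GL (Fin n) (mixedSpace K)) : Matrix (Fin n) (Fin n) (mixedSpace K)) i j‖ ≤ sz g)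
    (hI : ∀ (g : (archGroupGL n K).carrier) i j, ‖(((g⁻¹ : (archGroupGL n K).carrier) : GL (Fin n) (mixedSpace K)) :
      Matrix (Fin n) (Fin n) (mixedSpace K)) i j‖ ≤ sz g)
    {wt : Fin n → ℤ} (τ : K →+* ℂ) (v : GLnCohomology.CoeffModule ℂ n wt)
    (φ : Module.Dual ℂ (GLnCohomology.CoeffModule ℂ n wt)) :
    ∃ (C : ℝ) (k : ℕ), 0 ≤ C ∧ ∀ g, ‖φ (ParallelWeight.factorRep K n wt τ g v)‖ ≤ C * sz g ^ k := by
  obtain ⟨C₀, hC₀, hτ⟩ := cfg_exists_norm_embeddingExt_le (K := K)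
  set g' : (archGroupGL n K).carrier → GL (Fin n) ℂ := fun g =>
    Matrix.GeneralLinearGroup.map (embeddingExt τ : mixedSpace K →+* ℂ) (g : GL (Fin n) (mixedSpace K)) with hg'
  have hent : ∀ i j, ∃ (C : ℝ) (k : ℕ), 0 ≤ C ∧ ∀ g, ‖(g' g : Matrix (Fin n) (Fin n) ℂ) i j‖ ≤ C * sz g ^ k :=
    fun i j => ⟨C₀, 1, hC₀, fun g => by
      rw [pow_one, hg', Matrix.GeneralLinearGroup.map_apply]
      exact (hτ τ _).trans (mul_le_mul_of_nonneg_left (hE g i j) hC₀)⟩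
  have hent' : ∀ i j, ∃ (C : ℝ) (k : ℕ), 0 ≤ C ∧ ∀ g,
      ‖(((g' g)⁻¹ : GL (Fin n) ℂ) : Matrix (Fin n) (Fin n) ℂ) i j‖ ≤ C * sz g ^ k :=
    fun i j => ⟨C₀, 1, hC₀, fun g => by
      have e : (g' g)⁻¹ = Matrix.GeneralLinearGroup.map (embeddingExt τ : mixedSpace K →+* ℂ)
          ((g⁻¹ : (archGroupGL n K).carrier) : GL (Fin n) (mixedSpace K)) := by
        rw [hg', Subgroup.coe_inv, map_inv]
      rw [pow_one, e, Matrix.GeneralLinearGroup.map_apply]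
      exact (hτ τ _).trans (mul_le_mul_of_nonneg_left (hI g i j) hC₀)⟩
  obtain ⟨P, hP⟩ := Literature.NumberTheory.DiophantineGeometry.isPolynomialRep_weylRep_holds ℂ (Fin n)
    (GLnCohomology.coeffPartition wt) v φ
  have hformula : ∀ g, φ (ParallelWeight.factorRep K n wt τ g v) =
      (((Matrix.GeneralLinearGroup.det (g' g)) ^ GLnCohomology.lowestEntry wt : ℂˣ) : ℂ) *
        MvPolynomial.eval (fun ij : Fin n × Fin n => (g' g : Matrix (Fin n) (Fin n) ℂ) ij.1 ij.2) P := by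
    intro g
    rw [ParallelWeight.factorRep_apply, GLnCohomology.coeffRepGL_apply, map_smul, smul_eq_mul]
    exact congrArg _ (hP (g' g))
  have hdet : ∃ (C : ℝ) (k : ℕ), 0 ≤ C ∧ ∀ g,
      ‖(((Matrix.GeneralLinearGroup.det (g' g)) ^ GLnCohomology.lowestEntry wt : ℂˣ) : ℂ)‖ ≤ C * sz g ^ k := by
    obtain ⟨m, hm | hm⟩ := (GLnCohomology.lowestEntry wt).eq_nat_or_neg
    · refine cfg_mono sz (cfg_pow sz hsz (fun g => norm_nonneg _) (cfg_det_growth sz hsz hent) m) fun g => ?_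
      rw [hm, zpow_natCast, Units.val_pow_eq_pow_val, Matrix.GeneralLinearGroup.val_det_apply, norm_pow]
    · refine cfg_mono sz (cfg_pow sz hsz (fun g => norm_nonneg _) (cfg_det_growth sz hsz hent') m) fun g => ?_
      rw [hm, zpow_neg, ← inv_zpow, zpow_natCast, ← map_inv, Units.val_pow_eq_pow_val,
        Matrix.GeneralLinearGroup.val_det_apply, norm_pow]
  refine cfg_mono sz (cfg_mul sz (fun _ => norm_nonneg _) (fun _ => norm_nonneg _) hdet
    (cfg_eval_growth sz hsz (e := fun g (ij : Fin n × Fin n) => (g' g : Matrix (Fin n) (Fin n) ℂ) ij.1 ij.2)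
      (fun ij => hent ij.1 ij.2) P)) fun g => ?_
  rw [hformula g]
  exact norm_mul_le _ _

/-- **Matrix coefficients of `E_λ(ℂ) = ⨂_τ V_{λ_τ}` are polynomially bounded** (expand a pure tensor
in the tensor basis: products over `τ` of factor coefficients). [cite: BorelWallach2000, VII §2.2] -/
theorem cfg_archCoeffRep_dual_growth (hsz : ∀ g, 1 ≤ sz g)
    (hE : ∀ (g : (archGroupGL n K).carrier) i j,
      ‖((g : GL (Fin n) (mixedSpace K)) : Matrix (Fin n) (Fin n) (mixedSpace K)) i j‖ ≤ sz g)
    (hI : ∀ (g : (archGroupGL n K).carrier) i j, ‖(((g⁻¹ : (archGroupGL n K).carrier) : GL (Fin n) (mixedSpace K)) :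
      Matrix (Fin n) (Fin n) (mixedSpace K)) i j‖ ≤ sz g)
    (lam : (K →+* ℂ) → Fin n → ℤ) (v : ResGLnCohomology.CoeffModule ℂ n K lam)
    (ℓ : Module.Dual ℂ (ResGLnCohomology.CoeffModule ℂ n K lam)) :
    ∃ (C : ℝ) (k : ℕ), 0 ≤ C ∧ ∀ g, ‖ℓ (ResGLnCohomology.archCoeffRep n K lam g v)‖ ≤ C * sz g ^ k := by
  haveI : ∀ τ : K →+* ℂ, FiniteDimensional ℂ (GLnCohomology.CoeffModule ℂ n (lam τ)) := fun τ =>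
    ParallelWeight.finiteDimensional_coeffModule n (lam τ)
  induction v using ResGLnCohomology.CoeffModule.induction_on generalizing ℓ with
  | smul_tprod a w =>
    simp only [map_smul, smul_eq_mul]
    let b := fun τ : K →+* ℂ => Module.finBasis ℂ (GLnCohomology.CoeffModule ℂ n (lam τ))
    have hexp : ∀ g : (archGroupGL n K).carrier,
        ℓ (ResGLnCohomology.archCoeffRep n K lam g (ResGLnCohomology.CoeffModule.tprod w)) =
        ∑ J : (∀ τ : K →+* ℂ, Fin (Module.finrank ℂ (GLnCohomology.CoeffModule ℂ n (lam τ)))),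
          (∏ τ, (b τ).coord (J τ) (ParallelWeight.factorRep K n (lam τ) τ g (w τ))) *
            ℓ (ResGLnCohomology.CoeffModule.tprod fun τ => b τ (J τ)) := by
      intro g
      rw [ResGLnCohomology.archCoeffRep_apply_tprod]
      have hw : (fun τ => ParallelWeight.factorRep K n (lam τ) τ g (w τ)) =
          fun τ => ∑ j, ((b τ).coord j (ParallelWeight.factorRep K n (lam τ) τ g (w τ))) • b τ j :=
        funext fun τ => ((b τ).sum_repr _).symm
      rw [hw]
      change ℓ (PiTensorProduct.tprod ℂ fun τ => ∑ j,
        ((b τ).coord j (ParallelWeight.factorRep K n (lam τ) τ g (w τ))) • b τ j) = _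
      rw [MultilinearMap.map_sum (PiTensorProduct.tprod ℂ)
        (fun τ j => ((b τ).coord j (ParallelWeight.factorRep K n (lam τ) τ g (w τ))) • b τ j)]
      change ℓ (∑ r : (∀ τ : K →+* ℂ, Fin (Module.finrank ℂ (GLnCohomology.CoeffModule ℂ n (lam τ)))),
        (ResGLnCohomology.CoeffModule.tprod fun i => ((b i).coord (r i)
          (ParallelWeight.factorRep K n (lam i) i g (w i))) • b i (r i) :
          ResGLnCohomology.CoeffModule ℂ n K lam)) = _
      rw [map_sum ℓ]
      refine Finset.sum_congr rfl fun J _ => ?_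
      change ℓ (PiTensorProduct.tprod ℂ fun i => ((b i).coord (J i)
          (ParallelWeight.factorRep K n (lam i) i g (w i))) • b i (J i)) = _
      rw [MultilinearMap.map_smul_univ]
      change ℓ ((∏ i, (b i).coord (J i) (ParallelWeight.factorRep K n (lam i) i g (w i))) •
        (ResGLnCohomology.CoeffModule.tprod (fun i => b i (J i)) : ResGLnCohomology.CoeffModule ℂ n K lam)) = _
      rw [map_smul, smul_eq_mul]
    have hsumJ : ∃ (C : ℝ) (k : ℕ), 0 ≤ C ∧ ∀ g : (archGroupGL n K).carrier,
        ∑ J : (∀ τ : K →+* ℂ, Fin (Module.finrank ℂ (GLnCohomology.CoeffModule ℂ n (lam τ)))),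
          (∏ τ, ‖(b τ).coord (J τ) (ParallelWeight.factorRep K n (lam τ) τ g (w τ))‖) *
            ‖ℓ (ResGLnCohomology.CoeffModule.tprod fun τ => b τ (J τ))‖ ≤ C * sz g ^ k :=
      cfg_sum sz hsz _ fun J _ => cfg_mul sz (fun g => Finset.prod_nonneg fun _ _ => norm_nonneg _)
        (fun _ => norm_nonneg _)
        (cfg_prod sz hsz _ (fun _ _ _ => norm_nonneg _) fun τ _ =>
          cfg_factorRep_dual_growth sz hsz hE hI τ (w τ) ((b τ).coord (J τ)))
        (cfg_const sz hsz _)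
    refine cfg_mono sz (cfg_mul sz (fun _ => norm_nonneg _) (fun _ => norm_nonneg _) (cfg_const sz hsz ‖a‖)
      (cfg_mono sz hsumJ fun g => ?_)) fun g => norm_mul_le _ _
    rw [hexp g]
    refine (norm_sum_le _ _).trans (Finset.sum_le_sum fun J _ => ?_)
    rw [norm_mul]
    exact mul_le_mul_of_nonneg_right (Finset.norm_prod_le _ _) (norm_nonneg _)
  | add x y hx hy =>
    simp only [map_add]
    exact cfg_mono sz (cfg_add sz hsz (hx ℓ) (hy ℓ)) fun g => norm_add_le _ _

/-- Each coordinate of `E_λ(ℂ)` in `Module.finBasis` is bounded by the norm (the norm IS the sup of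
these coordinates). [folklore] -/
theorem cfg_coeff_norm_coord_le (lam : (K →+* ℂ) → Fin n → ℤ) (v : ResGLnCohomology.CoeffModule ℂ n K lam)
    (i : Fin (Module.finrank ℂ (ResGLnCohomology.CoeffModule ℂ n K lam))) :
    ‖(Module.finBasis ℂ (ResGLnCohomology.CoeffModule ℂ n K lam)).coord i v‖ ≤ ‖v‖ :=
  norm_le_pi_norm ((Module.finBasis ℂ (ResGLnCohomology.CoeffModule ℂ n K lam)).equivFun v) i

/-- The norm of `E_λ(ℂ)` is bounded by the sum of the coordinates. [folklore] -/
theorem cfg_coeff_norm_le_sum_coord (lam : (K →+* ℂ) → Fin n → ℤ) (v : ResGLnCohomology.CoeffModule ℂ n K lam) :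
    ‖v‖ ≤ ∑ i, ‖(Module.finBasis ℂ (ResGLnCohomology.CoeffModule ℂ n K lam)).coord i v‖ := by
  rw [show ‖v‖ = ‖(Module.finBasis ℂ (ResGLnCohomology.CoeffModule ℂ n K lam)).equivFun v‖ from rfl,
    pi_norm_le_iff_of_nonneg (Finset.sum_nonneg fun i _ => norm_nonneg _)]
  intro i
  exact Finset.single_le_sum (f := fun j => ‖(Module.finBasis ℂ (ResGLnCohomology.CoeffModule ℂ n K lam)).coord j v‖)
    (fun _ _ => norm_nonneg _) (Finset.mem_univ i)

/-- `|ε_S(g)| = 1` (the sign-of-determinant characters take the values `±1`). [folklore] -/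
theorem cfg_norm_signChar (S : Finset {w : InfinitePlace K // w.IsReal}) (g : (archGroupGL n K).carrier) :
    ‖ResGLnCohomology.signChar n K S g‖ = 1 := by
  rw [ResGLnCohomology.signChar_apply, norm_prod]
  refine Finset.prod_eq_one fun w _ => ?_
  have h := congrArg norm (RealMatrixGroup.signDetChar_sq (archGroupGL n K) (mixedSpaceEvalReal K w) g)
  rwa [norm_pow, norm_one, pow_eq_one_iff_of_nonneg (norm_nonneg _) two_ne_zero] at h

/-- **Uniform polynomial growth of the coefficient representation `E_λ(ℂ) ⊗ ε_S`**:
`‖(E_λ ⊗ ε_S)(g) v‖ ≤ C · sz(g)^k · ‖v‖` for any size `sz ≥ 1` dominating the entries of `g` and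
`g⁻¹` (matrix coefficients are `det^{λ_n}` times polynomials). [cite: BorelWallach2000, VII §2.2]
[cite: FultonHarrisGTM129, §15.5] -/
theorem cfg_archCoeffRepSign_growth (hsz : ∀ g, 1 ≤ sz g)
    (hE : ∀ (g : (archGroupGL n K).carrier) i j,
      ‖((g : GL (Fin n) (mixedSpace K)) : Matrix (Fin n) (Fin n) (mixedSpace K)) i j‖ ≤ sz g)
    (hI : ∀ (g : (archGroupGL n K).carrier) i j, ‖(((g⁻¹ : (archGroupGL n K).carrier) : GL (Fin n) (mixedSpace K)) :
      Matrix (Fin n) (Fin n) (mixedSpace K)) i j‖ ≤ sz g)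
    (S : Finset {w : InfinitePlace K // w.IsReal}) (lam : (K →+* ℂ) → Fin n → ℤ) :
    ∃ (C : ℝ) (k : ℕ), 0 ≤ C ∧ ∀ (g : (archGroupGL n K).carrier) (v : ResGLnCohomology.CoeffModule ℂ n K lam),
      ‖ResGLnCohomology.archCoeffRepSign n K S lam g v‖ ≤ C * sz g ^ k * ‖v‖ := by
  set b := Module.finBasis ℂ (ResGLnCohomology.CoeffModule ℂ n K lam) with hb
  have H : ∃ (C : ℝ) (k : ℕ), 0 ≤ C ∧ ∀ g : (archGroupGL n K).carrier,
      ∑ i, ‖ResGLnCohomology.archCoeffRep n K lam g (b i)‖ ≤ C * sz g ^ k := by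
    refine cfg_sum sz hsz _ fun i _ => ?_
    exact cfg_mono sz (cfg_sum sz hsz Finset.univ fun j _ =>
      cfg_archCoeffRep_dual_growth sz hsz hE hI lam (b i) (b.coord j)) fun g => by
        rw [hb]; exact cfg_coeff_norm_le_sum_coord lam _
  obtain ⟨C, k, hC, H⟩ := H
  refine ⟨C, k, hC, fun g v => ?_⟩
  rw [ResGLnCohomology.archCoeffRepSign_apply, _root_.norm_smul, cfg_norm_signChar, one_mul]
  have hv : v = ∑ i, b.coord i v • b i := (b.sum_repr v).symm
  calc ‖ResGLnCohomology.archCoeffRep n K lam g v‖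
      = ‖∑ i, b.coord i v • ResGLnCohomology.archCoeffRep n K lam g (b i)‖ := by
        conv_lhs => rw [hv]
        rw [map_sum]
        simp only [map_smul]
    _ ≤ ∑ i, ‖b.coord i v‖ * ‖ResGLnCohomology.archCoeffRep n K lam g (b i)‖ :=
        norm_sum_le_of_le _ fun i _ => by rw [_root_.norm_smul]
    _ ≤ ∑ i, ‖v‖ * ‖ResGLnCohomology.archCoeffRep n K lam g (b i)‖ :=
        Finset.sum_le_sum fun i _ => mul_le_mul_of_nonneg_right (by rw [hb]; exact cfg_coeff_norm_coord_le lam v i)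
          (norm_nonneg _)
    _ = ‖v‖ * ∑ i, ‖ResGLnCohomology.archCoeffRep n K lam g (b i)‖ := by rw [Finset.mul_sum]
    _ ≤ ‖v‖ * (C * sz g ^ k) := mul_le_mul_of_nonneg_left (H g) (norm_nonneg _)
    _ = C * sz g ^ k * ‖v‖ := by ring

end CoeffGrowth

/-- **Registered sub-goal (part 1 of stub `stub_coneForm_growth`): uniform polynomial growth of the
coefficient representation `E_λ(ℂ) ⊗ ε_S` of `G_∞ = GL_n(K_∞)`** in any size `sz ≥ 1` dominating the
entries of `g` and `g⁻¹`. [cite: BorelWallach2000, VII §2.2] [cite: FultonHarrisGTM129, §15.5] -/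
theorem stub_coneGrowth_coeffRep (n : ℕ) (K : Type) [Field K] [NumberField K]
    (sz : (archGroupGL n K).carrier → ℝ) (hsz : ∀ g, 1 ≤ sz g)
    (hE : ∀ (g : (archGroupGL n K).carrier) i j,
      ‖((g : GL (Fin n) (mixedSpace K)) : Matrix (Fin n) (Fin n) (mixedSpace K)) i j‖ ≤ sz g)
    (hI : ∀ (g : (archGroupGL n K).carrier) i j, ‖(((g⁻¹ : (archGroupGL n K).carrier) : GL (Fin n) (mixedSpace K)) :
      Matrix (Fin n) (Fin n) (mixedSpace K)) i j‖ ≤ sz g)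
    (S : Finset {w : InfinitePlace K // w.IsReal}) (lam : (K →+* ℂ) → Fin n → ℤ) :
    ∃ (C : ℝ) (k : ℕ), 0 ≤ C ∧ ∀ (g : (archGroupGL n K).carrier) (v : ResGLnCohomology.CoeffModule ℂ n K lam),
      ‖ResGLnCohomology.archCoeffRepSign n K S lam g v‖ ≤ C * sz g ^ k * ‖v‖ :=
  cfg_archCoeffRepSign_growth sz hsz hE hI S lam

end Summit.Langlands.Langlands.Theorems.HeckeEigenvalueField.Res

end
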